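/-
Copyright (c) 2026 the pub-hodgecm-mathlib formalisation cell (harness21).  Prover seat hodgecm-mathlib-R90-C131-p05 (g0), HCML SLAB R90-TF,
section S4 «Ch. 13.1–2» (dealer K2E2-plan (g6)), sub-socket S4#B7′ `stub_R90_S4_U2_ldsDecomp` of `Cruxes/H413/Lines/R90_S4_HPacketsU2B.lean`
ED. 4 (43a3df3d3e62), road «(DECOMP) ⟸ (RED) + UNITARY COMPLETE REDUCIBILITY».  2026-09-04.
-/
import Summits.HodgeConjecture.HodgeConjecture.Theorems.R90S4HLdsTwoOfDecomposable          -- ★ p862152 (this seat): `continuous_unitsCoe_of_isOpen_ker`, the (DECOMP) binder shape, carrier instances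
import Summits.HodgeConjecture.HodgeConjecture.Theorems.F0P3cStCharTSPrincipalSeriesUnitary  -- ★ «PS-UNITARY★» `isSemisimpleRepresentation_cmPrincipalSeries` (every `N`), `norm_apply_normOneUnits_eq_one`
import HarnessLib

/-!
# R90-TF · S4 «Ch. 13.1–2» — sub-socket S4#B7′ `stub_R90_S4_U2_ldsDecomp`: (DECOMP) FROM REDUCIBILITY ALONE — at a non-split `v`, a character
# `χ = (χ₁, χ₂)` of the diagonal torus of `U(Φ_N)(L⁺_v)` with `χ₁|F_v^× = ω_{E/F}` and `χ₁, χ₂` smooth is UNITARY, so `i_G(χ)` is completely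
# reducible and every proper non-zero `G`-stable `N` has a `G`-stable complement

Cell `hodgecm-mathlib`, crux H413 (`stmt-HodgeConjecture-24833`, lane `--supports … --as helper`), route of record `HCCMUnconditional`
(no route verbs; count-neutral).  Programme R90-TF (HUMAN RULING «R90-TF SLAB — MAX PUSH»; brief `director/R90-BRIEF.v2.md`
1f40d54518340a35), section S4 = Rogawski Ch. 13.1–2 (base `R90-C131`); seat R90-C131-p05 (g0); default hand (R35) on the residue of its own
socket S4#B5 after B ED. 4: sub-socket S4#B7′ `stub_R90_S4_U2_ldsDecomp` :393.  THEOREMS ONLY (no `def`, no instance, no notation, no named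
fact, no `sorry`); imports ★ only.

THE POINT.  B ED. 4 letters the residue of socket LDS as (DECOMP) «`i_{U(Φ₂)}((χ₁, χ₂))` has complementary subrepresentations `N ⊕ N′` with
`⊥ ≠ N ≠ ⊤`» [Rogawski1990, §11.1 p. 161 case 2): «`χ` is unitary and `i_G(χ)` is reducible, `i_G(χ) = π⁺ ⊕ π⁻`»].  Its two printed ingredients
are (RED) — `i_G(χ)` is REDUCIBLE at `χ₁|F^× = ω` (Keys–Shahidi, the normalised intertwining operator at the unitary self-dual point; the
analytic input) — and the SOFT half «`χ` unitary ⇒ `i_G(χ)` unitarisable and admissible ⇒ completely reducible».  The soft half is a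
theorem of the tree: ★ «PS-UNITARY★» `isSemisimpleRepresentation_cmPrincipalSeries` (F0P2-p06 (g19); the invariant form `∫_{K_v} f̄₁ f₂`, Iwasawa
`G = B K_v`, unimodularity, admissibility — [BernsteinZelevinsky1976, 2.25 (c)]) for EVERY `N` and every torus character of absolute value
`1`.  What this file adds is the absolute value: under the socket's guards `χ = (χ₁, χ₂)` IS unitary —
* `χ₂` is a continuous character of the COMPACT `E¹_v` (`v` non-split), so `|χ₂| = 1` (★ `norm_apply_normOneUnits_eq_one`);
* `χ₁|F_v^× = ω_{E/F}` (★ `IsQuadraticCharExtension`: on `σ`-fixed units `χ₁` is trivial exactly on the norms) forces `χ₁(a)² = χ₁(a²) = 1` for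
  every `σ`-fixed unit `a` (`a² = σ(a) a` is a norm), so `|χ₁| = 1` on `F_v^×`; then `|χ₁(σ x)| |χ₁(x)| = |χ₁(x σx)| = 1` and
  `|χ₁(σ x)| = |χ₁(x)|` (`σx · x⁻¹ ∈ E¹_v`, compact) give `|χ₁(x)|² = 1` — the argument of ★ `norm_apply_eq_one_of_apply_fixed_eq_one`
  (semi-regular case `χ₁|F^× = 1`) run with `|χ₁| = 1` on `F^×` in place of `χ₁ = 1` there.
Hence (DECOMP) ⟸ (RED): a proper non-zero `N` (from (RED)) and its complement (from complete reducibility).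

* §1 `norm_apply_eq_one_of_norm_apply_fixed_eq_one` — `v` non-split, `χ₁` continuous with `|χ₁| = 1` on the `σ`-fixed units ⇒ `|χ₁| = 1`;
  `norm_apply_eq_one_of_isQuadraticCharExtension` — the case `χ₁|F_v^× = ω_{E/F}`.
* §2 `norm_torusCharPair_eq_one_of_isQuadraticCharExtension` — `|(χ₁, χ₂)(t)| = 1` on the diagonal torus of `U(Φ_N)(L⁺_v)` (every `N`, every
  coordinate `i`); `isSemisimpleRepresentation_cmPrincipalSeries_torusCharPair` — `i_G((χ₁, χ₂))` is completely reducible (every `N`).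
* §3 `exists_isCompl_of_exists_ne_bot_ne_top_cmPrincipalSeries_two` — (DECOMP) at `(L, v, χ₁, χ₂)` from (RED) at `(L, v, χ₁, χ₂)`;
  **`stub_R90_S4_U2_ldsDecomp_of_reducible`** — the sub-socket's statement (bytes of B :393–:403) from (RED) «same guards ⇒
  `∃ N : Subrepresentation (i_{U(Φ₂)}((χ₁, χ₂))), N ≠ ⊥ ∧ N ≠ ⊤`».
NET RESIDUE of S4#B7′ after this file: (RED) ALONE — the reducibility of the unitary principal series `i_{U(1,1)}((χ₁, χ₂))` at
`χ₁|F_v^× = ω_{E_w/F_v}`, `v` non-split [Rogawski1990, §11.1 p. 161, §12.1 p. 171 case 2); Keys–Shahidi].  In Jacquet-module currency (★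
`jacquetFiltration_cmPrincipalSeries_two`, ★ Frobenius, ★ Schur) (RED) says: the two-dimensional `r_B i_G(χ)` is a SEMISIMPLE `T`-module at the
self-dual point `wχ = χ` — equivalently a second `N`-invariant `(χ δ_B^{1/2})`-eigenfunctional on `i_G(χ)` independent of `f ↦ f(1)` exists (the
regularised intertwining functional `f ↦ ∫_N f(wn) dn`).

HONEST LABEL: HC_CM is proved only modulo the 7 printed citations (2 remaining named inputs: hLiu418 = stmt-HodgeConjecture-24832,
h413 = stmt-HodgeConjecture-24833) until rung 0 closes; this file CLOSES NOTHING by itself — (RED) is NOT in the tree.  REL ≠ ★ ≠ BUILT.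

## Tree search
★ `isSemisimpleRepresentation_cmPrincipalSeries`, `norm_apply_normOneUnits_eq_one`, `norm_apply_eq_one_of_apply_fixed_eq_one` (pattern),
`compactSpace_normOneUnits`, `conjLocal_conjLocal_cm`, `mem_normOneUnits_iff`, `torusCharPair_apply`, `continuous_unitsCoe_of_isOpen_ker`,
`IsQuadraticCharExtension`; Mathlib `ComplementedLattice`, `exists_isCompl`, `eq_top_of_isCompl_bot`.  Dedup: `rg "norm_apply_eq_one_of_isQuadraticCharExtension"`,
`rg "ldsDecomp_of_reducible"`, `rg "isSemisimpleRepresentation_cmPrincipalSeries_torusCharPair"` — no hits.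

## References
* [Rogawski1990] J. D. Rogawski, *Automorphic Representations of Unitary Groups in Three Variables*, Ann. of Math. Stud. 123 (1990), §11.1 p. 161,
  §12.1 pp. 171–172, §4.8 p. 51.
* [BernsteinZelevinsky1976] I. N. Bernstein, A. V. Zelevinsky, *Representations of the group GL(n, F) where F is a non-archimedean local field*,
  Russian Math. Surveys 31:3 (1976), 2.25 (c).
* [Casselman1995] W. Casselman, *Introduction to the theory of admissible representations of 𝔭-adic reductive groups* (1995), Prop. 2.1.5, §3.1,
  Cor. 7.1.2, Prop. 7.1.3 p. 67.
* [Keys1984] D. Keys, *Principal series representations of special unitary groups over local fields*, Compositio Math. 51 (1984), §3, §7.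
-/

set_option autoImplicit false
-- the mandated namespace (brief §3.4) repeats the single-problem summit's segment (`HodgeConjecture.HodgeConjecture`)
set_option linter.dupNamespace false

noncomputable section

open NumberField IsDedekindDomain
open scoped MatrixGroups
open Literature.NumberTheory.Automorphic Literature.NumberTheory.Automorphic.UnitaryGroup

namespace Summit.HodgeConjecture.HodgeConjecture.R90.S4

variable (L : Type) [Field L] [NumberField L] [IsCMField L] (v : HeightOneSpectrum (𝓞 ↥(maximalRealSubfield L)))
  (hns : ∀ w : PlacesOver L v, IsCMField.complexConj L • w.1 = w.1)

/-! ## §1 `χ₁|F_v^× = ω_{E/F}` (more generally `|χ₁| = 1` on `F_v^×`) and `χ₁` continuous ⇒ `χ₁` is unitary (`v` non-split) -/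

include hns in
/-- **A continuous character `χ₁` of `E_v^×` with `|χ₁| = 1` on `F_v^×` is unitary** (`v` non-split).  For a unit `x`, `x · σ(x)` is `σ`-fixed, so
`|χ₁(σ x)| · |χ₁(x)| = 1`; and `u := σ(x) · x⁻¹` lies in the compact `E¹_v`, on which `|χ₁| = 1` (★ `norm_apply_normOneUnits_eq_one`), so
`|χ₁(σ x)| = |χ₁(x)|`; together `|χ₁(x)|² = 1` (the argument of ★ `norm_apply_eq_one_of_apply_fixed_eq_one` with norms throughout).
[cite: Rogawski1990, §12.1 p. 171; §12.2 (3) p. 173] -/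
theorem norm_apply_eq_one_of_norm_apply_fixed_eq_one (χ₁ : (LocalRing L v)ˣ →* ℂˣ) (h1 : Continuous fun x => ((χ₁ x : ℂˣ) : ℂ))
    (hfix : ∀ a : (LocalRing L v)ˣ, (conjLocal L (IsCMField.complexConj L) v) (a : LocalRing L v) = a → ‖((χ₁ a : ℂˣ) : ℂ)‖ = 1)
    (x : (LocalRing L v)ˣ) : ‖((χ₁ x : ℂˣ) : ℂ)‖ = 1 := by
  -- `σ` on units
  set σu : (LocalRing L v)ˣ →* (LocalRing L v)ˣ := Units.map (conjLocal L (IsCMField.complexConj L) v).toMonoidHom with hσu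
  have hσu_coe : ∀ y : (LocalRing L v)ˣ, ((σu y : (LocalRing L v)ˣ) : LocalRing L v) = conjLocal L (IsCMField.complexConj L) v (y : LocalRing L v) :=
    fun y => rfl
  have hσσ : ∀ y : LocalRing L v, conjLocal L (IsCMField.complexConj L) v (conjLocal L (IsCMField.complexConj L) v y) = y :=
    conjLocal_conjLocal_cm L v
  -- `σ` is an involution on units
  have hσuσu : σu (σu x) = x := Units.ext (by rw [hσu_coe, hσu_coe, hσσ])
  -- (a) `|χ₁(σ x)| · |χ₁(x)| = 1`: `x · σ x` is `σ`-fixed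
  have hfx : conjLocal L (IsCMField.complexConj L) v ((x * σu x : (LocalRing L v)ˣ) : LocalRing L v) = (x * σu x : (LocalRing L v)ˣ) := by
    rw [← hσu_coe, map_mul, hσuσu, mul_comm]
  have ha : ‖((χ₁ x : ℂˣ) : ℂ)‖ * ‖((χ₁ (σu x) : ℂˣ) : ℂ)‖ = 1 := by
    have h := hfix (x * σu x) hfx
    rwa [map_mul, Units.val_mul, norm_mul] at h
  -- (b) `|χ₁(σ x)| = |χ₁ x|`: `σ x · x⁻¹ ∈ E¹_v`
  have hmem : σu x * x⁻¹ ∈ normOneUnits (conjLocal L (IsCMField.complexConj L) v) := by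
    rw [mem_normOneUnits_iff, ← hσu_coe, ← Units.val_mul, map_mul, map_inv, hσuσu,
      show x * (σu x)⁻¹ * (σu x * x⁻¹) = 1 by group, Units.val_one]
  have hb : ‖((χ₁ (σu x) : ℂˣ) : ℂ)‖ = ‖((χ₁ x : ℂˣ) : ℂ)‖ := by
    have hres : Continuous fun b : ↥(normOneUnits (conjLocal L (IsCMField.complexConj L) v)) =>
        (((χ₁.comp (normOneUnits (conjLocal L (IsCMField.complexConj L) v)).subtype) b : ℂˣ) : ℂ) :=
      h1.comp continuous_subtype_val
    have hu := Cruxes.H413.F0P3cStCharTSPrincipalSeriesUnitary.norm_apply_normOneUnits_eq_one L v hns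
      (χ₁.comp (normOneUnits (conjLocal L (IsCMField.complexConj L) v)).subtype) hres ⟨_, hmem⟩
    simp only [MonoidHom.comp_apply, Subgroup.subtype_apply, map_mul, map_inv, Units.val_mul, Units.val_inv_eq_inv_val, norm_mul, norm_inv] at hu
    have hx0 : ‖((χ₁ x : ℂˣ) : ℂ)‖ ≠ 0 := norm_ne_zero_iff.2 (χ₁ x).ne_zero
    exact (mul_inv_eq_one₀ hx0).1 hu
  -- (c) conclude: `|χ₁ x|² = 1` with `|χ₁ x| > 0`
  rw [hb] at ha
  have hpos : 0 < ‖((χ₁ x : ℂˣ) : ℂ)‖ := norm_pos_iff.2 (χ₁ x).ne_zero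
  nlinarith [hpos, ha]

include hns in
/-- **`χ₁|F_v^× = ω_{E/F}` ⇒ `χ₁` is unitary** (`χ₁` continuous, `v` non-split).  On a `σ`-fixed unit `a`, `a² = σ(a) · a` is a norm, so
`χ₁(a)² = χ₁(a²) = 1` (★ `IsQuadraticCharExtension`: `χ₁` is trivial on the fixed norms), whence `|χ₁(a)| = 1`; then §1's first lemma.
(«in case 2), `χ` is unitary».) [cite: Rogawski1990, §11.1 p. 161; §12.1 p. 171; §4.8 p. 51] -/
theorem norm_apply_eq_one_of_isQuadraticCharExtension (χ₁ : (LocalRing L v)ˣ →* ℂˣ) (h1 : Continuous fun x => ((χ₁ x : ℂˣ) : ℂ))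
    (hq : IsQuadraticCharExtension (conjLocal L (IsCMField.complexConj L) v) χ₁) (x : (LocalRing L v)ˣ) : ‖((χ₁ x : ℂˣ) : ℂ)‖ = 1 := by
  refine norm_apply_eq_one_of_norm_apply_fixed_eq_one L v hns χ₁ h1 (fun a ha => ?_) x
  -- `a · a` is `σ`-fixed and a norm (`σ(a) · a = a · a`), so `χ₁(a · a) = 1`
  have hfix2 : conjLocal L (IsCMField.complexConj L) v ((a * a : (LocalRing L v)ˣ) : LocalRing L v) = (a * a : (LocalRing L v)ˣ) := by
    rw [Units.val_mul, map_mul, ha]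
  have hnorm : ∃ y : (LocalRing L v)ˣ, conjLocal L (IsCMField.complexConj L) v (y : LocalRing L v) * y = (a * a : (LocalRing L v)ˣ) :=
    ⟨a, by rw [ha, Units.val_mul]⟩
  have h2 : χ₁ (a * a) = 1 := (hq (a * a) hfix2).2 hnorm
  have hsq : ‖((χ₁ a : ℂˣ) : ℂ)‖ * ‖((χ₁ a : ℂˣ) : ℂ)‖ = 1 := by
    rw [← norm_mul, ← Units.val_mul, ← map_mul, h2, Units.val_one, norm_one]
  have hpos : 0 < ‖((χ₁ a : ℂˣ) : ℂ)‖ := norm_pos_iff.2 (χ₁ a).ne_zero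
  nlinarith [hpos, hsq]

/-! ## §2 The torus character `(χ₁, χ₂)` is unitary; `i_G((χ₁, χ₂))` is completely reducible (every `N`) -/

include hns in
/-- **`|(χ₁, χ₂)(t)| = 1`** on the diagonal torus of `U(Φ_N)(L⁺_v)` (★ `torusCharPair … i χ₁ χ₂ : t ↦ χ₁(t_i) · χ₂(det t)`), for continuous `χ₁, χ₂`
with `χ₁|F_v^× = ω_{E/F}`, `v` non-split (every `N`, every coordinate `i`): §1 and ★ `norm_apply_normOneUnits_eq_one`.
[cite: Rogawski1990, §11.1 p. 161; §12.1 p. 171] -/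
theorem norm_torusCharPair_eq_one_of_isQuadraticCharExtension (N : ℕ) (i : Fin N)
    (χ₁ : (LocalRing L v)ˣ →* ℂˣ) (χ₂ : ↥(normOneUnits (conjLocal L (IsCMField.complexConj L) v)) →* ℂˣ)
    (h1 : Continuous fun x => ((χ₁ x : ℂˣ) : ℂ)) (h2 : Continuous fun x => ((χ₂ x : ℂˣ) : ℂ))
    (hq : IsQuadraticCharExtension (conjLocal L (IsCMField.complexConj L) v) χ₁)
    (t : ↥(torusU (conjLocal L (IsCMField.complexConj L) v) (cmLocalForm L N v))) :
    ‖((torusCharPair (conjLocal L (IsCMField.complexConj L) v) (cmLocalForm L N v) (cmLocalForm_eq_over L N v) i χ₁ χ₂ t : ℂˣ) : ℂ)‖ = 1 := by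
  rw [torusCharPair_apply, Units.val_mul, norm_mul, norm_apply_eq_one_of_isQuadraticCharExtension L v hns χ₁ h1 hq,
    Cruxes.H413.F0P3cStCharTSPrincipalSeriesUnitary.norm_apply_normOneUnits_eq_one L v hns χ₂ h2, one_mul]

include hns in
/-- **`i_G((χ₁, χ₂))` on `U(Φ_N)(L⁺_v)` is COMPLETELY REDUCIBLE** for continuous `χ₁, χ₂` with `χ₁|F_v^× = ω_{E/F}`, `v` non-split (every `N`, every
coordinate `i`): ★ «PS-UNITARY★» `isSemisimpleRepresentation_cmPrincipalSeries` at the unitary character of §2 («`χ` is unitary ⋯ `i_G(χ) = π⁺ ⊕ π⁻`»).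
[cite: BernsteinZelevinsky1976, 2.25 (c)] [cite: Rogawski1990, §11.1 p. 161; §12.1 p. 171] -/
theorem isSemisimpleRepresentation_cmPrincipalSeries_torusCharPair (N : ℕ) (i : Fin N)
    (χ₁ : (LocalRing L v)ˣ →* ℂˣ) (χ₂ : ↥(normOneUnits (conjLocal L (IsCMField.complexConj L) v)) →* ℂˣ)
    (h1 : Continuous fun x => ((χ₁ x : ℂˣ) : ℂ)) (h2 : Continuous fun x => ((χ₂ x : ℂˣ) : ℂ))
    (hq : IsQuadraticCharExtension (conjLocal L (IsCMField.complexConj L) v) χ₁) :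
    (cmPrincipalSeries L N v
      (torusCharPair (conjLocal L (IsCMField.complexConj L) v) (cmLocalForm L N v) (cmLocalForm_eq_over L N v) i χ₁ χ₂)).IsSemisimpleRepresentation :=
  Cruxes.H413.F0P3cStCharTSPrincipalSeriesUnitary.isSemisimpleRepresentation_cmPrincipalSeries L N v _
    (norm_torusCharPair_eq_one_of_isQuadraticCharExtension L v hns N i χ₁ χ₂ h1 h2 hq)

/-! ## §3 (DECOMP) ⟸ (RED) on `U(Φ₂)(L⁺_v)` -/

include hns in
set_option synthInstance.maxHeartbeats 400000 in  -- instance paths on the CM carrier (as ★ p862152 §3)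
set_option maxHeartbeats 1600000 in  -- statement-heavy (`Subrepresentation (cmPrincipalSeries …)` binders); no search
/-- **(DECOMP) ⟸ (RED) at `(L, v, χ₁, χ₂)`** (`v` non-split; `χ₁, χ₂` with open kernels; `χ₁|F_v^× = ω_{E/F}`): a proper non-zero `G`-stable `N ≤ i_{U(Φ₂)}((χ₁, χ₂))`
has a `G`-stable complement `N′` (complete reducibility, §2), so `i((χ₁, χ₂)) = N ⊕ N′` non-trivially — «`i_G(χ) = π⁺ ⊕ π⁻`».
[cite: Rogawski1990, §11.1 p. 161 case 2); §12.1 p. 171] [cite: BernsteinZelevinsky1976, 2.25 (c)] -/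
theorem exists_isCompl_of_exists_ne_bot_ne_top_cmPrincipalSeries_two
    (χ₁ : (LocalRing L v)ˣ →* ℂˣ) (χ₂ : ↥(normOneUnits (conjLocal L (IsCMField.complexConj L) v)) →* ℂˣ)
    (hχ₁ : IsOpen ((χ₁.ker : Subgroup (LocalRing L v)ˣ) : Set (LocalRing L v)ˣ))
    (hχ₂ : IsOpen ((χ₂.ker : Subgroup ↥(normOneUnits (conjLocal L (IsCMField.complexConj L) v))) :
      Set ↥(normOneUnits (conjLocal L (IsCMField.complexConj L) v))))
    (hq : IsQuadraticCharExtension (conjLocal L (IsCMField.complexConj L) v) χ₁)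
    (hRed : ∃ N : Subrepresentation (cmPrincipalSeries L 2 v
        (torusCharPair (conjLocal L (IsCMField.complexConj L) v) (cmLocalForm L 2 v) (cmLocalForm_eq_over L 2 v) 0 χ₁ χ₂)), N ≠ ⊥ ∧ N ≠ ⊤) :
    ∃ N N' : Subrepresentation (cmPrincipalSeries L 2 v
        (torusCharPair (conjLocal L (IsCMField.complexConj L) v) (cmLocalForm L 2 v) (cmLocalForm_eq_over L 2 v) 0 χ₁ χ₂)),
      IsCompl N N' ∧ N ≠ ⊥ ∧ N ≠ ⊤ := by
  haveI := isSemisimpleRepresentation_cmPrincipalSeries_torusCharPair L v hns 2 0 χ₁ χ₂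
    (continuous_unitsCoe_of_isOpen_ker χ₁ hχ₁) (continuous_unitsCoe_of_isOpen_ker χ₂ hχ₂) hq
  obtain ⟨N, hb, ht⟩ := hRed
  obtain ⟨N', hc⟩ := exists_isCompl N
  exact ⟨N, N', hc, hb, ht⟩

set_option synthInstance.maxHeartbeats 400000 in  -- as above
set_option maxHeartbeats 1600000 in  -- statement-heavy composition; no search
/-- **SUB-SOCKET S4#B7′ `stub_R90_S4_U2_ldsDecomp` FROM (RED)** — the sub-socket's statement (bytes of `Lines/R90_S4_HPacketsU2B.lean` ED. 4 :393–:403, B's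
`abbrev`s being the tree names used here) from the ONE printed analytic input (RED): «at a non-split `v`, for smooth `χ₁, χ₂` with `χ₁|F_v^× = ω_{E/F}`, the
principal series `i_{U(Φ₂)}((χ₁, χ₂))` is REDUCIBLE» [Keys–Shahidi; §11.1 p. 161 case 2)].  The unitarity of `χ` and the splitting `i_G(χ) = π⁺ ⊕ π⁻` are
theorems (§§1–3).  ED. 5 pay line: `stub_R90_S4_U2_ldsDecomp := stub_R90_S4_U2_ldsDecomp_of_reducible stub_R90_S4_U2_ldsRed` for a sub-socket `_ldsRed`
with the binder's bytes. [cite: Rogawski1990, §11.1 p. 161 case 2); §12.1 p. 171] [cite: Keys1984, §3, §7] [cite: BernsteinZelevinsky1976, 2.25 (c)] -/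
theorem stub_R90_S4_U2_ldsDecomp_of_reducible
    (hRed : ∀ (L : Type) [Field L] [NumberField L] [IsCMField L] (v : HeightOneSpectrum (𝓞 ↥(maximalRealSubfield L))),
      (∀ w : PlacesOver L v, IsCMField.complexConj L • w.1 = w.1) →
      ∀ (χ₁ : (LocalRing L v)ˣ →* ℂˣ) (χ₂ : ↥(normOneUnits (conjLocal L (IsCMField.complexConj L) v)) →* ℂˣ),
        IsOpen ((χ₁.ker : Subgroup (LocalRing L v)ˣ) : Set (LocalRing L v)ˣ) →
        IsOpen ((χ₂.ker : Subgroup ↥(normOneUnits (conjLocal L (IsCMField.complexConj L) v))) :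
          Set ↥(normOneUnits (conjLocal L (IsCMField.complexConj L) v))) →
        IsQuadraticCharExtension (conjLocal L (IsCMField.complexConj L) v) χ₁ →
        ∃ N : Subrepresentation (cmPrincipalSeries L 2 v
            (torusCharPair (conjLocal L (IsCMField.complexConj L) v) (cmLocalForm L 2 v) (cmLocalForm_eq_over L 2 v) 0 χ₁ χ₂)),
          N ≠ ⊥ ∧ N ≠ ⊤) :
    ∀ (L : Type) [Field L] [NumberField L] [IsCMField L] (v : HeightOneSpectrum (𝓞 ↥(maximalRealSubfield L))),
      (∀ w : PlacesOver L v, IsCMField.complexConj L • w.1 = w.1) →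
      ∀ (χ₁ : (LocalRing L v)ˣ →* ℂˣ) (χ₂ : ↥(normOneUnits (conjLocal L (IsCMField.complexConj L) v)) →* ℂˣ),
        IsOpen ((χ₁.ker : Subgroup (LocalRing L v)ˣ) : Set (LocalRing L v)ˣ) →
        IsOpen ((χ₂.ker : Subgroup ↥(normOneUnits (conjLocal L (IsCMField.complexConj L) v))) :
          Set ↥(normOneUnits (conjLocal L (IsCMField.complexConj L) v))) →
        IsQuadraticCharExtension (conjLocal L (IsCMField.complexConj L) v) χ₁ →
        ∃ N N' : Subrepresentation (cmPrincipalSeries L 2 v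
            (torusCharPair (conjLocal L (IsCMField.complexConj L) v) (cmLocalForm L 2 v) (cmLocalForm_eq_over L 2 v) 0 χ₁ χ₂)),
          IsCompl N N' ∧ N ≠ ⊥ ∧ N ≠ ⊤ :=
  fun L _ _ _ v hv χ₁ χ₂ hχ₁ hχ₂ hq =>
    exists_isCompl_of_exists_ne_bot_ne_top_cmPrincipalSeries_two L v hv χ₁ χ₂ hχ₁ hχ₂ hq (hRed L v hv χ₁ χ₂ hχ₁ hχ₂ hq)

end Summit.HodgeConjecture.HodgeConjecture.R90.S4

end
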